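import Literature.MathematicalPhysics.QuantumFieldTheory.Balaban1983to89.Node00.LinearisedAveragingAtBackground
import Literature.MathematicalPhysics.QuantumFieldTheory.Balaban1983to89.B16Sect1Backgrounds
import Literature.MathematicalPhysics.QuantumFieldTheory.Balaban1983to89.Node00.WilsonActionSecondVariationGauge

/-!
# NODE 00 — GAUGE COVARIANCE AND LOCALITY OF THE LINEARISED AVERAGING: `Q_k(U^u)(Ad_u X)(c) = Ad_{ū(c₊)}((Q_k(U)X)(c))`, and the (0.4) window
# passes to the one-step derivative (module D4-cov∕loc of the [15] Sect. B audit of seat `pub-ymgap-dag-n07-w1`; pointers (iv)–(v) of dag-n07-e's word)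

Cell `pub-ymgap`, width seat `pub-ymgap-dag-n07-w1` generation 0 (DAG node N07 = [15] = [Balaban1985Variational]; item (α), pointers (iv) COVARIANCE (S3's (153) consumers) and
(v) LOCALITY (k0-s1's top-domain letters); INTENT-5 l.26821 + AMEND).
NEW leaf, THEOREMS ONLY (0 `def`), `--kind proof --supports stmt-QuantumFields-20542` (K1⁷), count-neutral.  CONSUMED BY NAME, nothing modified: this seat's definer
`Node00.LinearisedAveragingAtBackground` (`dIterL` = `Q_k`, `qLin`, `hasDerivAt_coe_iter_expChart_smul`), r13's `B16Sect1Backgrounds.iter_gaugeAct` (covariance of the ITERATED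
averages, [Balaban1985Averaging] (11) scale by scale) and `toMS` (the restrictions `u↾T^{(k)}`), `BlockAveraging.small_gaugeAct_iff` (the guard is gauge invariant),
`T4AdjointCovarianceUnitary.specialUnitaryAd`, n21∕node00's `Node00.WilsonActionSecondVariationGauge` (★ `expChart_gaugeAct`: `U^u·exp(Ad_{u(b₊)}X) = (U·exp X)^u`,
`specialUnitaryAd_smul_apply` — BY NAME), 35a `expChart`, 35b `coeField_iter_eq_iterM`; for §2
`BlockAveraging.blockOf_src_of_mem_walk` (every loop bond issues from `B(c₋) ∪ B(c₊)`), `walkEnd_replicate_line`, `AveragingRT.blockOf_lineSite`.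

THE PRINT.  [Balaban1985Averaging] (11) p. 19 (`Ū^u = (Ū)^{ū}`); [Balaban1985Variational] (44) p. 285 with (153) p. 301 (the operators of Sect. C transform covariantly under the
gauge group; S3's consumers); [Balaban1985BackgroundPropagators] (3.29) p. 395 (`R(u)` on Lie-algebra fields).  Differentiating `Ū^k((U·exp(tX))^u) = (Ū^k(U·exp(tX)))^{ū}` at
`t = 0`, with `(U·exp(tX))^u = U^u·exp(t·Ad_{u(b₊)}X)` bond-wise (the LEFT-trivialised chart moves the transformation to the TARGET endpoint).

CONTENTS (torus `P`, level `k ≤ m + K` — the standing range of `iter_gaugeAct`; `ū = toMS u k`).  `smallBelow_gaugeAct`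
(35b's guard below `k` is gauge invariant), ★★ `dIterL_gaugeAct_velField` (the chart velocity transforms by `ū(c₋)·(velocity)·ū(c₊)⋆`), ★★★ `qLin_gaugeAct` —
**`(qLin k U^u (Ad_{u∘tgt} X))(c) = ū(c₊)·(qLin k U X)(c)·ū(c₊)⋆`** under `SmallBelow … k U`; `qLin_gaugeAct_avOfRecord` (at NODE 00's objects).
§2 LOCALITY (one step, level `j`, polydisc): `dHolL_congr`, ★ `dAvgL_apply_congr` (`(dAvgL V₀ Y)(c)` depends only on `Y` at the loop and segment bonds of `c`),
`exists_lineSite_of_mem_walk_replicate`, `blockOf_src_of_mem_walk_replicate`, ★★ `dAvgL_apply_congr_of_window` (direction fields agreeing on the bonds issuing from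
`B(c₋) ∪ B(c₊)` have the same derivative at `c`; the `k`-fold window follows by `dIterL_succ` and is left to the consumer's block conventions).

HONEST FRAMING: bookkeeping (uniqueness of derivatives + the tree's covariance of the true averaging); nothing of [15]'s estimates; the statement is on the guard and in the
standing range `k ≤ m + K` only; N07 NOT discharged; counts unmoved (5∕27); one finite 𝕋⁴ programme at fixed ε — NOT continuum ∕ ℝ⁴ ∕ OS ∕ mass gap ∕ Clay (R4 closes the conditional
finite-𝕋⁴ rung `BalabanLadder.UV` only).  No `sorry`, no `def`, no `instance`, no `notation`.
-/

noncomputable section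

namespace Literature.MathematicalPhysics.QuantumFieldTheory.Balaban1983to89.Node00

open Filter Topology
open T4Continuum BlockAveraging B15DeterminingSets
open ExpMeanLog (expMeanLogSU)
open T4AdjointCovarianceUnitary (lieSU expSU)
open scoped Matrix.Norms.L2Operator


section Covariance

open B16Sect1Backgrounds (toMS iter_gaugeAct)
open T4AdjointCovarianceUnitary (specialUnitaryAd coe_specialUnitaryAd)

variable {P : Params} {N : ℕ} [NeZero N]

/-- 35b's guard below `k ≤ m + K` is gauge invariant (`iter_gaugeAct` + `small_gaugeAct_iff`). [cite: Balaban1985Averaging, (11) p.19; Balaban1987RG1, (0.4) p.253] -/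
theorem smallBelow_gaugeAct {k : ℕ} (hk : k ≤ P.m + P.K) (u : GaugeTransf P 0 (SU N)) {U : GaugeField P 0 (SU N)}
    (h : SmallBelow (fun j => blockAvg (P := P) (j := j) expMeanLogSU) k U) :
    SmallBelow (fun j => blockAvg (P := P) (j := j) expMeanLogSU) k (GaugeField.gaugeAct u U) := by
  intro j hj c
  rw [iter_gaugeAct (fun j => blockAvg (P := P) (j := j) expMeanLogSU) u U j ((le_of_lt hj).trans hk)]
  exact (small_gaugeAct_iff expMeanLogSU _ _ c).2 (h j hj c)

/-- ★★ **COVARIANCE OF THE CHART VELOCITY**: under the guard below `k ≤ m + K`, `(Q_k(↑U^u)[b ↦ U^u_b·Ad_{u(b₊)}X_b])(c) = ū(c₋)·(Q_k(↑U)[b ↦ U_b·X_b])(c)·ū(c₊)⋆`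
(both sides are the velocity at `0` of `t ↦ ↑Ū^k((U·exp(tX))^u)(c) = ū(c₋)·↑Ū^k(U·exp(tX))(c)·ū(c₊)⋆`). [cite: Balaban1985Averaging, (11) p.19; Balaban1985Variational, (44) p.285, (153) p.301] -/
theorem dIterL_gaugeAct_velField {k : ℕ} (hk : k ≤ P.m + P.K) (u : GaugeTransf P 0 (SU N)) {U : GaugeField P 0 (SU N)}
    (h : SmallBelow (fun j => blockAvg (P := P) (j := j) expMeanLogSU) k U) (X : PBond P 0 → lieSU (Fin N)) (c : PBond P k) :
    dIterL k (coeField (GaugeField.gaugeAct u U))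
        (fun b => ((GaugeField.gaugeAct u U b : SU N) : Matrix (Fin N) (Fin N) ℂ) * ((specialUnitaryAd (u b.tgt) (X b) : lieSU (Fin N)) : Matrix (Fin N) (Fin N) ℂ)) c =
      (toMS u k c.src : Matrix (Fin N) (Fin N) ℂ) *
        dIterL k (coeField U) (fun b => (U b : Matrix (Fin N) (Fin N) ℂ) * (X b : Matrix (Fin N) (Fin N) ℂ)) c *
        star (toMS u k c.tgt : Matrix (Fin N) (Fin N) ℂ) := by
  -- LHS = velocity of `t ↦ ↑Ū^k(U^u·exp(t·AdX))(c)`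
  have hL := hasDerivAt_coe_iter_expChart_smul (smallBelow_gaugeAct hk u h) (fun b => specialUnitaryAd (u b.tgt) (X b)) c
  -- the same function is `t ↦ ū(c₋) ↑Ū^k(U·exp(tX))(c) ū(c₊)⋆`
  have hfun : (fun t : ℝ => ((Averaging.iter (fun j => blockAvg (P := P) (j := j) expMeanLogSU) k
      (expChart (GaugeField.gaugeAct u U) (t • fun b => specialUnitaryAd (u b.tgt) (X b))) c : SU N) : Matrix (Fin N) (Fin N) ℂ)) =
      fun t : ℝ => (toMS u k c.src : Matrix (Fin N) (Fin N) ℂ) *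
        ((Averaging.iter (fun j => blockAvg (P := P) (j := j) expMeanLogSU) k (expChart U (t • X)) c : SU N) : Matrix (Fin N) (Fin N) ℂ) *
        star (toMS u k c.tgt : Matrix (Fin N) (Fin N) ℂ) := by
    funext t
    rw [← specialUnitaryAd_smul_apply, expChart_gaugeAct, iter_gaugeAct _ u _ k hk]
    show ((toMS u k c.src * _ * (toMS u k c.tgt)⁻¹ : SU N) : Matrix (Fin N) (Fin N) ℂ) = _
    rw [Submonoid.coe_mul, Submonoid.coe_mul]
    rfl
  have hR : HasDerivAt (fun t : ℝ => (toMS u k c.src : Matrix (Fin N) (Fin N) ℂ) *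
        ((Averaging.iter (fun j => blockAvg (P := P) (j := j) expMeanLogSU) k (expChart U (t • X)) c : SU N) : Matrix (Fin N) (Fin N) ℂ) *
        star (toMS u k c.tgt : Matrix (Fin N) (Fin N) ℂ))
      ((toMS u k c.src : Matrix (Fin N) (Fin N) ℂ) *
        dIterL k (coeField U) (fun b => (U b : Matrix (Fin N) (Fin N) ℂ) * (X b : Matrix (Fin N) (Fin N) ℂ)) c *
        star (toMS u k c.tgt : Matrix (Fin N) (Fin N) ℂ)) 0 :=
    ((hasDerivAt_coe_iter_expChart_smul h X c).const_mul _).mul_const _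
  rw [hfun] at hL
  exact hL.unique hR

/-- ★★★ **GAUGE COVARIANCE OF `Q_k`** (left-trivialised reading): under the guard below `k ≤ m + K`, `(qLin k U^u (Ad_{u∘tgt}X))(c) = ū(c₊)·(qLin k U X)(c)·ū(c₊)⋆` — print's
`Q_k(U₀^u)(R(u)X) = R(ū)(Q_k(U₀)X)`. [cite: Balaban1985Variational, (44) p.285, (153) p.301; Balaban1985Averaging, (11) p.19; Balaban1985BackgroundPropagators, (3.29) p.395] -/
theorem qLin_gaugeAct {k : ℕ} (hk : k ≤ P.m + P.K) (u : GaugeTransf P 0 (SU N)) {U : GaugeField P 0 (SU N)}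
    (h : SmallBelow (fun j => blockAvg (P := P) (j := j) expMeanLogSU) k U) (X : PBond P 0 → lieSU (Fin N)) (c : PBond P k) :
    qLin k (GaugeField.gaugeAct u U) (fun b => specialUnitaryAd (u b.tgt) (X b)) c =
      (toMS u k c.tgt : Matrix (Fin N) (Fin N) ℂ) * qLin k U X c * star (toMS u k c.tgt : Matrix (Fin N) (Fin N) ℂ) := by
  have hu := smallBelow_gaugeAct hk u h
  rw [qLin_apply, qLin_apply, ← coeField_iter_eq_iterM k hu, ← coeField_iter_eq_iterM k h, coeField_apply, coeField_apply,
    iter_gaugeAct _ u U k hk]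
  have hvel : (fun b => ((GaugeField.gaugeAct (toMS u 0) U b : SU N) : Matrix (Fin N) (Fin N) ℂ) *
      ((specialUnitaryAd (u b.tgt) (X b) : lieSU (Fin N)) : Matrix (Fin N) (Fin N) ℂ)) =
      fun b => ((GaugeField.gaugeAct u U b : SU N) : Matrix (Fin N) (Fin N) ℂ) * ((specialUnitaryAd (u b.tgt) (X b) : lieSU (Fin N)) : Matrix (Fin N) (Fin N) ℂ) := rfl
  show star ((GaugeField.gaugeAct (toMS u k) (Averaging.iter _ k U) c : SU N) : Matrix (Fin N) (Fin N) ℂ) * _ = _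
  rw [dIterL_gaugeAct_velField hk u h X c]
  show star ((toMS u k c.src * Averaging.iter _ k U c * (toMS u k c.tgt)⁻¹ : SU N) : Matrix (Fin N) (Fin N) ℂ) * _ = _
  have hinv : (((toMS u k c.tgt)⁻¹ : SU N) : Matrix (Fin N) (Fin N) ℂ) = star (toMS u k c.tgt : Matrix (Fin N) (Fin N) ℂ) := rfl
  rw [Submonoid.coe_mul, Submonoid.coe_mul, hinv, star_mul, star_mul, star_star]
  set a : Matrix (Fin N) (Fin N) ℂ := (toMS u k c.src : Matrix (Fin N) (Fin N) ℂ)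
  set b : Matrix (Fin N) (Fin N) ℂ := (toMS u k c.tgt : Matrix (Fin N) (Fin N) ℂ)
  set W : Matrix (Fin N) (Fin N) ℂ := ((Averaging.iter (fun j => blockAvg (P := P) (j := j) expMeanLogSU) k U c : SU N) : Matrix (Fin N) (Fin N) ℂ)
  set V : Matrix (Fin N) (Fin N) ℂ := dIterL k (coeField U) (fun b => (U b : Matrix (Fin N) (Fin N) ℂ) * (X b : Matrix (Fin N) (Fin N) ℂ)) c
  have ha : star a * a = 1 := Unitary.star_mul_self_of_mem (Matrix.specialUnitaryGroup_le_unitaryGroup (toMS u k c.src).2)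
  calc b * (star W * star a) * (a * V * star b) = b * star W * (star a * a) * V * star b := by noncomm_ring
    _ = b * (star W * V) * star b := by rw [ha]; noncomm_ring

end Covariance

section CovarianceRecord

open B16Sect1Backgrounds (toMS)
open T4AdjointCovarianceUnitary (specialUnitaryAd)

variable {F : T4Family} {N : ℕ} [NeZero N]

/-- At NODE 00's objects (`avOfRecord F N K j = blockAvg expMeanLogSU`, `rfl`): the gauge covariance of `Q_k` on the torus `F.P K`, `k ≤ m + K`.
[cite: Balaban1985Variational, (44) p.285, (153) p.301; Balaban1985Averaging, (11) p.19] -/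
theorem qLin_gaugeAct_avOfRecord {K k : ℕ} (hk : k ≤ (F.P K).m + (F.P K).K) (u : GaugeTransf (F.P K) 0 (SU N)) {U : GaugeField (F.P K) 0 (SU N)}
    (h : SmallBelow (avOfRecord F N K) k U) (X : PBond (F.P K) 0 → lieSU (Fin N)) (c : PBond (F.P K) k) :
    qLin k (GaugeField.gaugeAct u U) (fun b => specialUnitaryAd (u b.tgt) (X b)) c =
      (toMS u k c.tgt : Matrix (Fin N) (Fin N) ℂ) * qLin k U X c * star (toMS u k c.tgt : Matrix (Fin N) (Fin N) ℂ) :=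
  qLin_gaugeAct hk u h X c

end CovarianceRecord

/-! ## §2  LOCALITY: the (0.4) window passes to the one-step derivative -/

section Locality

variable {P : Params} {j : ℕ} {N : ℕ}

/-- The derivative of a walk product in the direction `Y` depends only on `Y` at the bonds OF THE WALK. [cite: Balaban1985Averaging, (58) p.27 (bookkeeping)] -/
theorem dHolL_congr {V₀ Y Y' : PBond P j → Matrix (Fin N) (Fin N) ℂ} :
    ∀ {γ : List (LStep P j)}, (∀ s ∈ γ, Y s.bond = Y' s.bond) → dHolL V₀ γ Y = dHolL V₀ γ Y'
  | [], _ => by simp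
  | s :: γ, h => by
    have hs : stepM Y s = stepM Y' s := by
      unfold stepM
      rw [h s (List.mem_cons_self)]
    rw [dHolL_cons_apply, dHolL_cons_apply, hs, dHolL_congr fun s' hs' => h s' (List.mem_cons_of_mem s hs')]

/-- ★ **ONE-STEP LOCALITY OF THE LINEARISED AVERAGING**: in the polydisc, `(dAvgL V₀ Y)(c)` depends only on `Y` at the bonds of the (0.4) loops and of the straight segment
of `c`. [cite: Balaban1985Averaging, p.19 («second condition»), (124) p.36; Balaban1987RG1, (0.4) p.253] -/
theorem dAvgL_apply_congr {V₀ Y Y' : PBond P j → Matrix (Fin N) (Fin N) ℂ} (h : ∀ (c : PBond P (j + 1)) (i : Idx P), ‖loopM V₀ c i - 1‖ < 1)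
    (c : PBond P (j + 1))
    (hloop : ∀ (i : Idx P), ∀ s ∈ walk (emb c.src) (loopWord P.L c.dir (off i.1) i.2.1 i.2.2), Y s.bond = Y' s.bond)
    (hax : ∀ s ∈ walk (emb c.src) (List.replicate P.L (c.dir, true)), Y s.bond = Y' s.bond) :
    dAvgL V₀ Y c = dAvgL V₀ Y' c := by
  rw [dAvgL_apply h, dAvgL_apply h, dHolL_congr hax]
  have hl : (fun i : Idx P => dHolL V₀ (walk (emb c.src) (loopWord P.L c.dir (off i.1) i.2.1 i.2.2)) Y) =
      fun i : Idx P => dHolL V₀ (walk (emb c.src) (loopWord P.L c.dir (off i.1) i.2.1 i.2.2)) Y' :=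
    funext fun i => dHolL_congr (hloop i)
  rw [hl]

/-- Every step of the straight walk of `n` steps from `emb c₋` issues from a line site `lineSite c t`, `t < n` (`BlockAveraging.walkEnd_replicate_line`). [cite: Balaban1984PropagatorsI, (1.7) p.18 (bookkeeping)] -/
theorem exists_lineSite_of_mem_walk_replicate (c : PBond P (j + 1)) :
    ∀ (n : ℕ) (s : LStep P j), s ∈ walk (emb c.src) (List.replicate n (c.dir, true)) → ∃ t, t < n ∧ s.bond.src = AveragingRT.lineSite c t
  | 0, s, hs => by simp [walk] at hs
  | n + 1, s, hs => by
    rw [List.replicate_succ', walk_append, List.mem_append, walkEnd_replicate_line] at hs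
    rcases hs with hs | hs
    · obtain ⟨t, ht, hts⟩ := exists_lineSite_of_mem_walk_replicate c n s hs
      exact ⟨t, Nat.lt_succ_of_lt ht, hts⟩
    · refine ⟨n, Nat.lt_succ_self n, ?_⟩
      simp only [walk, List.mem_cons, List.not_mem_nil, or_false] at hs
      rw [hs]

/-- Every bond of the straight segment `[c₋, c₊]` issues from `B(c₋) ∪ B(c₊)` (standing range; `AveragingRT.blockOf_lineSite`).  Summits-side twin (cell BalabanUV, not importable into
Literature): `Summit.QuantumFields.BalabanUV.T4Continuum.Spine.NE7.blockOf_src_of_mem_axWalk`. [cite: Balaban1985Averaging, (15) p.19 (bookkeeping)] -/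
theorem blockOf_src_of_mem_walk_replicate (hj : j + 1 ≤ P.m + P.K) (c : PBond P (j + 1)) (s : LStep P j)
    (hs : s ∈ walk (emb c.src) (List.replicate P.L (c.dir, true))) : blockOf s.bond.src = c.src ∨ blockOf s.bond.src = c.tgt := by
  obtain ⟨t, ht, hts⟩ := exists_lineSite_of_mem_walk_replicate c P.L s hs
  rw [hts]
  exact AveragingRT.blockOf_lineSite hj c ht

/-- ★★ **THE (0.4) WINDOW PASSES TO THE DERIVATIVE**: in the polydisc and the standing range `j + 1 ≤ m + K`, if two direction fields agree on every bond issuing from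
`B(c₋) ∪ B(c₊)` then `(dAvgL V₀ Y)(c) = (dAvgL V₀ Y′)(c)` — the linearised form of `Setup.Averaging.local_dep` ∕ `BlockAveraging.avgFun_local`.
[cite: Balaban1985Averaging, p.19 («second condition»), (15) p.19; Balaban1987RG1, (0.4) p.253] -/
theorem dAvgL_apply_congr_of_window (hj : j + 1 ≤ P.m + P.K) {V₀ Y Y' : PBond P j → Matrix (Fin N) (Fin N) ℂ}
    (h : ∀ (c : PBond P (j + 1)) (i : Idx P), ‖loopM V₀ c i - 1‖ < 1) (c : PBond P (j + 1))
    (hw : ∀ b : PBond P j, blockOf b.src = c.src ∨ blockOf b.src = c.tgt → Y b = Y' b) :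
    dAvgL V₀ Y c = dAvgL V₀ Y' c :=
  dAvgL_apply_congr h c (fun i s hs => hw s.bond (blockOf_src_of_mem_walk hj c i s hs))
    (fun s hs => hw s.bond (blockOf_src_of_mem_walk_replicate hj c s hs))

end Locality

end Literature.MathematicalPhysics.QuantumFieldTheory.Balaban1983to89.Node00

end
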